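import Mathlib
import Literature.Analysis.Convexity.BrunnMinkowski
import HarnessLib

/-!
# A Brunn–Minkowski inequality for HEIGHT-DEPENDENT summands under slice domination
# ("chimera Brunn–Minkowski") — continuum brick for line `LayerChain`, stub `chimera`, of crux
# `StackingLiminf` (stmt-Ventures-19145)

Route `StickyWulffConstant` of the venture `Summits/Ventures/Crystal3D` (cell `crystal3d-full`).
The planner's stub `chimera` (cf-p1 g10, `Lines/LayerChain.md` (b)) lower-bounds the energy of a
layered set `A` with a height-dependent letter profile by transporting `A` onto the "chimera" body
assembled slice by slice from the stacking Wulff bodies `W_{f(z)}`, using only SLICE DOMINATION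
`|W_f ∩ {z = y}| ≥ |W_0 ∩ {z = y}|` (= `stub_sliceDomination`, landed p476944).  This file proves the
volume inequality underneath that step WITHOUT transport, by the slice proof of Brunn–Minkowski:

* `chimera_volume_rpow_mul_le` (multiplicative form): in `ℝⁿ × ℝ` (horizontal `EuclideanSpace ℝ (Fin n)`,
  vertical `ℝ`), let `A, C, W₀` be measurable, `W : ℝ → Set (ℝⁿ × ℝ)` a family of measurable bodies
  indexed by HEIGHT whose horizontal slices dominate those of `W₀`
  (`∀ t u, |{x | (x,u) ∈ W₀}| ≤ |{x | (x,u) ∈ W t}|`), and suppose `C` contains every chimera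
  combination `(1−s)a + s w`, `a ∈ A`, `w ∈ W(a₂)` (the summand is chosen by the height of `a`).
  Then `|A|^{1−s} · |W₀|^s ≤ |C|` (`0 < s < 1`).
  Proof: for heights `t, u` the slice `C_{(1−s)t+su}` contains `(1−s)A_t + s(W t)_u`, so the tree's
  multiplicative Brunn–Minkowski inequality in `ℝⁿ` (`volume_rpow_mul_volume_rpow_le`) and slice
  domination give `|C_{(1−s)t+su}| ≥ |A_t|^{1−s}|(W₀)_u|^s`; the tree's Prékopa–Leindler inequality on
  the line (`prekopaLeindler_real`) and Fubini finish.  Only the slice AREAS of the summands enter —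
  which is why a height-dependent summand with dominating slices is as good as `W₀` itself.
* `chimera_brunnMinkowski_pow` (additive form): if `C ⊇ {a + w | a ∈ A, w ∈ W(a₂)}` then
  `(|A|^{1/(n+1)} + |W₀|^{1/(n+1)})^{n+1} ≤ |C|` — stated as `ofReal ((a+b)^{n+1}) ≤ |C|` whenever
  `ofReal (a^{n+1}) ≤ |A|`, `ofReal (b^{n+1}) ≤ |W₀|` (homogeneity, as in the tree's `brunnMinkowski_pow`).
Consequence for the line (not formalised here): with `W(z) = r·W_{f(z)}` and `W₀ = r·W_0` the chimera
neighbourhood `A +_f rW` has volume `≥ (|A|^{1/3} + r|W_0|^{1/3})³` for EVERY profile `f` (no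
measurability or stationarity of `f` needed), i.e. the Minkowski-content form of the chimera Wulff
bound `≥ 3|W_0|^{1/3}|A|^{2/3}` of `LayerChain.md` (b), replacing the Knothe-map regularity there.
WHAT THIS IS NOT: not the Γ-liminf half of stub `chimera` (blow-up / reduced boundary), not a
statement about perimeters; nothing discrete; rung F-C1 not moved.
-/

noncomputable section

namespace Summit.Ventures.Crystal3D.Theorems.Chimera

open MeasureTheory Set
open Literature.Analysis.Convexity (volume_rpow_mul_volume_rpow_le prekopaLeindler_real)
open scoped ENNReal Pointwise

variable {n : ℕ}

/-- Horizontal slices of a measurable set are measurable. -/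
theorem measurableSet_hslice {S : Set (EuclideanSpace ℝ (Fin n) × ℝ)} (hS : MeasurableSet S)
    (t : ℝ) : MeasurableSet {x : EuclideanSpace ℝ (Fin n) | (x, t) ∈ S} :=
  hS.preimage (measurable_id.prodMk measurable_const)

/-- The slice-area function of a measurable set is measurable. -/
theorem measurable_volume_hslice {S : Set (EuclideanSpace ℝ (Fin n) × ℝ)} (hS : MeasurableSet S) :
    Measurable fun t : ℝ => volume {x : EuclideanSpace ℝ (Fin n) | (x, t) ∈ S} :=
  measurable_measure_prodMk_right hS

/-- Cavalieri: the volume of a measurable set is the integral of its slice areas. -/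
theorem volume_eq_lintegral_hslice {S : Set (EuclideanSpace ℝ (Fin n) × ℝ)} (hS : MeasurableSet S) :
    volume S = ∫⁻ t : ℝ, volume {x : EuclideanSpace ℝ (Fin n) | (x, t) ∈ S} := by
  rw [Measure.volume_eq_prod, Measure.prod_apply_symm hS]
  rfl

/-- **Chimera Brunn–Minkowski inequality, multiplicative form.**  See the module docstring:
height-dependent summands `W t` whose horizontal slices dominate those of `W₀`;
`|A|^{1−s}·|W₀|^s ≤ |C|` for every measurable `C` containing the chimera combinations
`(1−s)a + s w`, `a ∈ A`, `w ∈ W(a₂)`. -/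
theorem chimera_volume_rpow_mul_le {s : ℝ} (hs0 : 0 < s) (hs1 : s < 1)
    {A C W₀ : Set (EuclideanSpace ℝ (Fin n) × ℝ)} (W : ℝ → Set (EuclideanSpace ℝ (Fin n) × ℝ))
    (hA : MeasurableSet A) (hC : MeasurableSet C) (hW₀ : MeasurableSet W₀)
    (hW : ∀ t, MeasurableSet (W t))
    (hdom : ∀ t u, volume {x : EuclideanSpace ℝ (Fin n) | (x, u) ∈ W₀} ≤
      volume {x : EuclideanSpace ℝ (Fin n) | (x, u) ∈ W t})
    (hsub : ∀ a ∈ A, ∀ w ∈ W a.2, (1 - s) • a + s • w ∈ C) :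
    volume A ^ (1 - s) * volume W₀ ^ s ≤ volume C := by
  set φ : ℝ → ℝ≥0∞ := fun t => volume {x : EuclideanSpace ℝ (Fin n) | (x, t) ∈ A} with hφ
  set ψ : ℝ → ℝ≥0∞ := fun u => volume {x : EuclideanSpace ℝ (Fin n) | (x, u) ∈ W₀} with hψ
  set h : ℝ → ℝ≥0∞ := fun z => volume {x : EuclideanSpace ℝ (Fin n) | (x, z) ∈ C} with hh
  have key : ∀ t u, φ t ^ (1 - s) * ψ u ^ s ≤ h ((1 - s) • t + s • u) := by
    intro t u
    have hincl : (1 - s) • {x : EuclideanSpace ℝ (Fin n) | (x, t) ∈ A} +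
        s • {x : EuclideanSpace ℝ (Fin n) | (x, u) ∈ W t} ⊆
        {x : EuclideanSpace ℝ (Fin n) | (x, (1 - s) • t + s • u) ∈ C} := by
      intro x hx
      obtain ⟨_, ⟨a', ha', rfl⟩, _, ⟨w', hw', rfl⟩, rfl⟩ := hx
      have h1 := hsub (a', t) ha' (w', u) hw'
      simpa using h1
    have h2 := volume_rpow_mul_volume_rpow_le hs0 hs1 (measurableSet_hslice hA t)
      (measurableSet_hslice (hW t) u) (measurableSet_hslice hC _) hincl
    calc φ t ^ (1 - s) * ψ u ^ s
        ≤ volume {x : EuclideanSpace ℝ (Fin n) | (x, t) ∈ A} ^ (1 - s) *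
            volume {x : EuclideanSpace ℝ (Fin n) | (x, u) ∈ W t} ^ s := by
          gcongr
          exact hdom t u
      _ ≤ h ((1 - s) • t + s • u) := h2
  have pl := prekopaLeindler_real hs0 hs1 (measurable_volume_hslice hA)
    (measurable_volume_hslice hW₀) (measurable_volume_hslice hC) key
  rw [volume_eq_lintegral_hslice hA, volume_eq_lintegral_hslice hW₀, volume_eq_lintegral_hslice hC]
  exact pl

/-! ### The additive (homogeneous) form -/

/-- Volume of a dilate in `ℝⁿ × ℝ`: `|r • S| = |r|ⁿ⁺¹ |S|`. -/
theorem volume_smul_prod (r : ℝ) (S : Set (EuclideanSpace ℝ (Fin n) × ℝ)) :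
    volume (r • S) = ENNReal.ofReal (|r| ^ (n + 1)) * volume S := by
  rw [Measure.volume_eq_prod, Measure.addHaar_smul, Module.finrank_prod, finrank_euclideanSpace_fin,
    Module.finrank_self, abs_pow]

/-- Horizontal slices of a dilate: `{x | (x, u) ∈ r • S} = r • {x | (x, r⁻¹u) ∈ S}` (`r ≠ 0`). -/
theorem hslice_smul {r : ℝ} (hr : r ≠ 0) (S : Set (EuclideanSpace ℝ (Fin n) × ℝ)) (u : ℝ) :
    {x : EuclideanSpace ℝ (Fin n) | (x, u) ∈ r • S} =
      r • {x : EuclideanSpace ℝ (Fin n) | (x, r⁻¹ * u) ∈ S} := by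
  ext x
  rw [Set.mem_setOf_eq, Set.mem_smul_set_iff_inv_smul_mem₀ hr, Set.mem_smul_set_iff_inv_smul_mem₀ hr,
    Set.mem_setOf_eq, Prod.smul_mk, smul_eq_mul]

/-- **Chimera Brunn–Minkowski inequality, additive form.**  In `ℝⁿ × ℝ` let `A, C, W₀` be
measurable and `W : ℝ → Set (ℝⁿ × ℝ)` measurable bodies indexed by height whose horizontal slices
dominate those of `W₀`; if `C ⊇ {a + w | a ∈ A, w ∈ W(a₂)}` (each point of `A` carries the summand of
ITS OWN height) then for `a, b > 0` with `aⁿ⁺¹ ≤ |A|`, `bⁿ⁺¹ ≤ |W₀|`: `(a + b)ⁿ⁺¹ ≤ |C|`, i.e.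
`|C|^{1/(n+1)} ≥ |A|^{1/(n+1)} + |W₀|^{1/(n+1)}`.  (Homogeneity on top of the multiplicative form,
as in the tree's `brunnMinkowski_pow`: dilate `A` by `a⁻¹`, the family by `b⁻¹` — re-indexed by the
dilated heights — and `C` by `(a+b)⁻¹`, with `s = b/(a+b)`.) -/
theorem chimera_brunnMinkowski_pow
    {A C W₀ : Set (EuclideanSpace ℝ (Fin n) × ℝ)} (W : ℝ → Set (EuclideanSpace ℝ (Fin n) × ℝ))
    (hA : MeasurableSet A) (hC : MeasurableSet C) (hW₀ : MeasurableSet W₀)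
    (hW : ∀ t, MeasurableSet (W t))
    (hdom : ∀ t u, volume {x : EuclideanSpace ℝ (Fin n) | (x, u) ∈ W₀} ≤
      volume {x : EuclideanSpace ℝ (Fin n) | (x, u) ∈ W t})
    (hsub : ∀ a ∈ A, ∀ w ∈ W a.2, a + w ∈ C)
    {a b : ℝ} (ha : 0 < a) (hb : 0 < b) (hvA : ENNReal.ofReal (a ^ (n + 1)) ≤ volume A)
    (hvB : ENNReal.ofReal (b ^ (n + 1)) ≤ volume W₀) :
    ENNReal.ofReal ((a + b) ^ (n + 1)) ≤ volume C := by
  have hab : 0 < a + b := add_pos ha hb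
  set s : ℝ := b / (a + b) with hs
  have hs0 : 0 < s := div_pos hb hab
  have hs1 : s < 1 := (div_lt_one hab).2 (by linarith)
  have h1s : 1 - s = a / (a + b) := by rw [hs]; field_simp; ring
  -- dilated data
  have hvA' : 1 ≤ volume (a⁻¹ • A) := by
    rw [volume_smul_prod, abs_of_pos (inv_pos.2 ha)]
    calc (1 : ℝ≥0∞) = ENNReal.ofReal (a⁻¹ ^ (n + 1)) * ENNReal.ofReal (a ^ (n + 1)) := by
          rw [← ENNReal.ofReal_mul (pow_nonneg (inv_pos.2 ha).le _), ← mul_pow,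
            inv_mul_cancel₀ ha.ne', one_pow, ENNReal.ofReal_one]
      _ ≤ ENNReal.ofReal (a⁻¹ ^ (n + 1)) * volume A := by gcongr
  have hvB' : 1 ≤ volume (b⁻¹ • W₀) := by
    rw [volume_smul_prod, abs_of_pos (inv_pos.2 hb)]
    calc (1 : ℝ≥0∞) = ENNReal.ofReal (b⁻¹ ^ (n + 1)) * ENNReal.ofReal (b ^ (n + 1)) := by
          rw [← ENNReal.ofReal_mul (pow_nonneg (inv_pos.2 hb).le _), ← mul_pow,
            inv_mul_cancel₀ hb.ne', one_pow, ENNReal.ofReal_one]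
      _ ≤ ENNReal.ofReal (b⁻¹ ^ (n + 1)) * volume W₀ := by gcongr
  -- slice domination survives the common dilation `b⁻¹` (and re-indexing of the heights)
  have hdom' : ∀ t u, volume {x : EuclideanSpace ℝ (Fin n) | (x, u) ∈ b⁻¹ • W₀} ≤
      volume {x : EuclideanSpace ℝ (Fin n) | (x, u) ∈ b⁻¹ • W (a * t)} := by
    intro t u
    rw [hslice_smul (inv_ne_zero hb.ne'), hslice_smul (inv_ne_zero hb.ne'), Measure.addHaar_smul,
      Measure.addHaar_smul]
    exact mul_le_mul' le_rfl (hdom _ _)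
  -- the chimera combination of the dilated data lies in `(a+b)⁻¹ • C`
  have hsub' : ∀ a' ∈ a⁻¹ • A, ∀ w' ∈ (fun t => b⁻¹ • W (a * t)) a'.2,
      (1 - s) • a' + s • w' ∈ (a + b)⁻¹ • C := by
    intro a' ha' w' hw'
    obtain ⟨x, hx, rfl⟩ := Set.mem_smul_set.1 ha'
    obtain ⟨y, hy, rfl⟩ := Set.mem_smul_set.1 hw'
    have hxy : x + y ∈ C := by
      refine hsub x hx y ?_
      have e : a * (a⁻¹ • x).2 = x.2 := by
        rw [Prod.smul_snd, smul_eq_mul, ← mul_assoc, mul_inv_cancel₀ ha.ne', one_mul]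
      rwa [e] at hy
    refine Set.mem_smul_set.2 ⟨x + y, hxy, ?_⟩
    rw [h1s, hs, smul_smul, smul_smul, div_mul_eq_mul_div, mul_inv_cancel₀ ha.ne',
      div_mul_eq_mul_div, mul_inv_cancel₀ hb.ne', one_div, smul_add]
  have hmult := chimera_volume_rpow_mul_le hs0 hs1 (fun t => b⁻¹ • W (a * t))
    (hA.const_smul₀ a⁻¹) (hC.const_smul₀ (a + b)⁻¹) (hW₀.const_smul₀ b⁻¹)
    (fun t => (hW (a * t)).const_smul₀ b⁻¹) hdom' hsub'
  have hone : (1 : ℝ≥0∞) ≤ volume ((a + b)⁻¹ • C) := by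
    calc (1 : ℝ≥0∞) = 1 ^ (1 - s) * 1 ^ s := by rw [ENNReal.one_rpow, ENNReal.one_rpow, one_mul]
      _ ≤ volume (a⁻¹ • A) ^ (1 - s) * volume (b⁻¹ • W₀) ^ s :=
          mul_le_mul' (ENNReal.rpow_le_rpow hvA' (by linarith)) (ENNReal.rpow_le_rpow hvB' hs0.le)
      _ ≤ volume ((a + b)⁻¹ • C) := hmult
  rw [volume_smul_prod, abs_of_pos (inv_pos.2 hab)] at hone
  calc ENNReal.ofReal ((a + b) ^ (n + 1)) = ENNReal.ofReal ((a + b) ^ (n + 1)) * 1 := (mul_one _).symm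
    _ ≤ ENNReal.ofReal ((a + b) ^ (n + 1)) *
        (ENNReal.ofReal ((a + b)⁻¹ ^ (n + 1)) * volume C) := by gcongr
    _ = volume C := by
        rw [← mul_assoc, ← ENNReal.ofReal_mul (pow_nonneg hab.le _), ← mul_pow,
          mul_inv_cancel₀ hab.ne', one_pow, ENNReal.ofReal_one, one_mul]

/-- **Chimera Brunn–Minkowski, root form** (`n + 1 ≥ 1`): under the hypotheses of
`chimera_brunnMinkowski_pow` with `0 < |A|`, `0 < |W₀|`, both finite,
`|A|^{1/(n+1)} + |W₀|^{1/(n+1)} ≤ |C|^{1/(n+1)}`. -/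
theorem chimera_brunnMinkowski
    {A C W₀ : Set (EuclideanSpace ℝ (Fin n) × ℝ)} (W : ℝ → Set (EuclideanSpace ℝ (Fin n) × ℝ))
    (hA : MeasurableSet A) (hC : MeasurableSet C) (hW₀ : MeasurableSet W₀)
    (hW : ∀ t, MeasurableSet (W t))
    (hdom : ∀ t u, volume {x : EuclideanSpace ℝ (Fin n) | (x, u) ∈ W₀} ≤
      volume {x : EuclideanSpace ℝ (Fin n) | (x, u) ∈ W t})
    (hsub : ∀ a ∈ A, ∀ w ∈ W a.2, a + w ∈ C)
    (hA0 : volume A ≠ 0) (hAt : volume A ≠ ⊤) (hB0 : volume W₀ ≠ 0) (hBt : volume W₀ ≠ ⊤) :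
    volume A ^ ((n + 1 : ℕ)⁻¹ : ℝ) + volume W₀ ^ ((n + 1 : ℕ)⁻¹ : ℝ) ≤
      volume C ^ ((n + 1 : ℕ)⁻¹ : ℝ) := by
  have hn : (n + 1 : ℕ) ≠ 0 := Nat.succ_ne_zero n
  have hn0 : (0 : ℝ) < ((n + 1 : ℕ)⁻¹ : ℝ) := by positivity
  set a : ℝ := (volume A).toReal ^ ((n + 1 : ℕ)⁻¹ : ℝ) with ha_def
  set b : ℝ := (volume W₀).toReal ^ ((n + 1 : ℕ)⁻¹ : ℝ) with hb_def
  have ha : 0 < a := Real.rpow_pos_of_pos (ENNReal.toReal_pos hA0 hAt) _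
  have hb : 0 < b := Real.rpow_pos_of_pos (ENNReal.toReal_pos hB0 hBt) _
  have han : ENNReal.ofReal (a ^ (n + 1)) = volume A := by
    rw [ha_def, Real.rpow_inv_natCast_pow ENNReal.toReal_nonneg hn, ENNReal.ofReal_toReal hAt]
  have hbn : ENNReal.ofReal (b ^ (n + 1)) = volume W₀ := by
    rw [hb_def, Real.rpow_inv_natCast_pow ENNReal.toReal_nonneg hn, ENNReal.ofReal_toReal hBt]
  have hpow := chimera_brunnMinkowski_pow W hA hC hW₀ hW hdom hsub ha hb han.le hbn.le
  have hroot := ENNReal.rpow_le_rpow hpow hn0.le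
  rw [ENNReal.ofReal_rpow_of_nonneg (pow_nonneg (add_nonneg ha.le hb.le) _) hn0.le,
    Real.pow_rpow_inv_natCast (add_nonneg ha.le hb.le) hn, ENNReal.ofReal_add ha.le hb.le] at hroot
  have hA' : ENNReal.ofReal a = volume A ^ ((n + 1 : ℕ)⁻¹ : ℝ) := by
    rw [ha_def, ← ENNReal.ofReal_rpow_of_nonneg ENNReal.toReal_nonneg hn0.le,
      ENNReal.ofReal_toReal hAt]
  have hB' : ENNReal.ofReal b = volume W₀ ^ ((n + 1 : ℕ)⁻¹ : ℝ) := by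
    rw [hb_def, ← ENNReal.ofReal_rpow_of_nonneg ENNReal.toReal_nonneg hn0.le,
      ENNReal.ofReal_toReal hBt]
  rwa [hA', hB'] at hroot

end Summit.Ventures.Crystal3D.Theorems.Chimera

end
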